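import Summits.MatrixMultiplication.MatrixMultiplication.Theses.LevelGradedCohnUmans
import Summits.MatrixMultiplication.MatrixMultiplication.Theorems.LieRankDesigns.Negative.Basics

/-!
# `LieRankBeatsCubes` (crux stmt-MatrixMultiplication-14057), negative lane: the Borel configuration of
# `GL_2(𝔽_p)` — subgroups `U⁻`, `T`, `U⁺`, LDU calculus, TPP and volume

Negative-lane support file of the crux disprover (cdisprove seat
`refuter-cdisprove-stmt-MatrixMultiplication-14057-0`); everything `sorry`-free, no Theses statement is
asserted.  Vocabulary (`GLm`, `Mat`, `fourierFn`, `RankSupp`, `RankSep`) is the landed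
`Theorems/LieRankDesigns/Negative/Basics.lean`.

Content: the one-parameter subgroups `uMinus γ = [1 0; γ 1]`, `uPlus β = [1 β; 0 1]`, the torus
`torU a d = diag(a, d)` of `GL_2(𝔽_p)` and the finite sets `Uminus p`, `Torus p`, `Uplus p`; the LDU product
`[1 0; γ 1]·diag(a,d)·[1 β; 0 1] = [a, aβ; γa, γaβ + d]` (`coe_ldu`, `quad_ldu`); LDU uniqueness at the identity
(`ldu_eq_one`); **the Borel configuration `(U⁻, T, U⁺)` has the triple product property**
(`borelConfiguration_tpp`) **and volume `p²(p−1)²`** (`borelConfiguration_volume`) — the "prime-field frontier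
`|G|·p/(p+1)`" of the crux text.  The companion file `BorelConfiguration.lean` proves it is NOT rank-1 separated.
-/

noncomputable section

open scoped BigOperators

namespace Summit.MatrixMultiplication.MatrixMultiplication.Theorems.LieRankBeatsCubes.Negative

open Summit.MatrixMultiplication.MatrixMultiplication.Theorems.LieRankDesigns.Negative

variable {p : ℕ} [Fact p.Prime]


/-- Lower unitriangular `[1 0; γ 1]`. -/
def uMinus (γ : ZMod p) : GLm p 2 :=
  Matrix.GeneralLinearGroup.mkOfDetNeZero !![1, 0; γ, 1] (by simp [Matrix.det_fin_two])

/-- Upper unitriangular `[1 β; 0 1]`. -/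
def uPlus (β : ZMod p) : GLm p 2 :=
  Matrix.GeneralLinearGroup.mkOfDetNeZero !![1, β; 0, 1] (by simp [Matrix.det_fin_two])

/-- Diagonal torus element `diag(a, d)`. -/
def torU (a d : (ZMod p)ˣ) : GLm p 2 :=
  Matrix.GeneralLinearGroup.mkOfDetNeZero !![(a : ZMod p), 0; 0, (d : ZMod p)]
    (by simp [Matrix.det_fin_two, a.ne_zero, d.ne_zero])

/-- Underlying matrix of `uMinus`. -/
@[simp] theorem coe_uMinus (γ : ZMod p) : ((uMinus γ : GLm p 2) : Mat p 2) = !![1, 0; γ, 1] := rfl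
/-- Underlying matrix of `uPlus`. -/
@[simp] theorem coe_uPlus (β : ZMod p) : ((uPlus β : GLm p 2) : Mat p 2) = !![1, β; 0, 1] := rfl
/-- Underlying matrix of `torU`. -/
@[simp] theorem coe_torU (a d : (ZMod p)ˣ) :
    ((torU a d : GLm p 2) : Mat p 2) = !![(a : ZMod p), 0; 0, (d : ZMod p)] := rfl

/-- `U⁻ ⊂ GL_2(𝔽_p)` as a finite set. -/
def Uminus (p : ℕ) [Fact p.Prime] : Finset (GLm p 2) := Finset.univ.image uMinus

/-- `U⁺ ⊂ GL_2(𝔽_p)` as a finite set. -/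
def Uplus (p : ℕ) [Fact p.Prime] : Finset (GLm p 2) := Finset.univ.image uPlus

/-- The diagonal torus `T ⊂ GL_2(𝔽_p)` as a finite set. -/
def Torus (p : ℕ) [Fact p.Prime] : Finset (GLm p 2) :=
  (Finset.univ : Finset ((ZMod p)ˣ × (ZMod p)ˣ)).image fun ad => torU ad.1 ad.2

/-- `γ ↦ [1 0; γ 1]` is injective. -/
theorem uMinus_injective : Function.Injective (uMinus (p := p)) := by
  intro γ γ' h
  have := congrArg (fun g : GLm p 2 => (g : Mat p 2) 1 0) h
  simpa using this

/-- `β ↦ [1 β; 0 1]` is injective. -/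
theorem uPlus_injective : Function.Injective (uPlus (p := p)) := by
  intro β β' h
  have := congrArg (fun g : GLm p 2 => (g : Mat p 2) 0 1) h
  simpa using this

/-- `(a, d) ↦ diag(a, d)` is injective. -/
theorem torU_injective : Function.Injective (fun ad : (ZMod p)ˣ × (ZMod p)ˣ => torU ad.1 ad.2) := by
  rintro ⟨a, d⟩ ⟨a', d'⟩ h
  have h1 := congrArg (fun g : GLm p 2 => (g : Mat p 2) 0 0) h
  have h2 := congrArg (fun g : GLm p 2 => (g : Mat p 2) 1 1) h
  simp only [coe_torU, Matrix.of_apply, Matrix.cons_val', Matrix.cons_val_zero, Matrix.cons_val_one,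
    Matrix.cons_val_fin_one] at h1 h2
  exact Prod.ext (Units.ext h1) (Units.ext h2)

/-- `|U⁻| = p`. -/
theorem card_Uminus : (Uminus p).card = p := by
  rw [Uminus, Finset.card_image_of_injective _ uMinus_injective, Finset.card_univ, ZMod.card]

/-- `|U⁺| = p`. -/
theorem card_Uplus : (Uplus p).card = p := by
  rw [Uplus, Finset.card_image_of_injective _ uPlus_injective, Finset.card_univ, ZMod.card]

/-- `|T| = (p − 1)²`. -/
theorem card_Torus : (Torus p).card = (p - 1) ^ 2 := by
  rw [Torus, Finset.card_image_of_injective _ torU_injective, Finset.card_univ, Fintype.card_prod,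
    ZMod.card_units_eq_totient, Nat.totient_prime (Fact.out), sq]

/-- `U⁻` is a subgroup: `(uMinus (−γ))⁻¹ = uMinus γ`. -/
theorem uMinus_neg_inv (γ : ZMod p) : (uMinus (-γ))⁻¹ = uMinus γ := by
  rw [inv_eq_iff_eq_inv, eq_comm, inv_eq_iff_mul_eq_one]
  apply Units.ext
  simp [Matrix.one_fin_two]

/-- `diag(1, 1) = 1`. -/
theorem torU_one : torU (1 : (ZMod p)ˣ) 1 = 1 := by
  apply Units.ext
  simp [Matrix.one_fin_two]

/-- The LDU product `[1 0; γ 1]·diag(a, d)·[1 β; 0 1] = [a, aβ; γa, γaβ + d]`. -/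
theorem coe_ldu (γ : ZMod p) (a d : (ZMod p)ˣ) (β : ZMod p) :
    ((uMinus γ * torU a d * uPlus β : GLm p 2) : Mat p 2) =
      !![(a : ZMod p), a * β; γ * a, γ * a * β + d] := by
  simp

/-- The quadruple product of the separation clause for `x = uMinus (−γ)`, `y = torU a d`, `y' = 1`,
`z = uPlus β` is the LDU product. -/
theorem quad_ldu (γ : ZMod p) (a d : (ZMod p)ˣ) (β : ZMod p) :
    (uMinus (-γ))⁻¹ * torU a d * (torU (1 : (ZMod p)ˣ) 1)⁻¹ * uPlus β = uMinus γ * torU a d * uPlus β := by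
  rw [uMinus_neg_inv, torU_one, inv_one, mul_one]

/-- `uMinus γ ∈ U⁻`. -/
theorem uMinus_mem (γ : ZMod p) : uMinus γ ∈ Uminus p := Finset.mem_image_of_mem _ (Finset.mem_univ _)
/-- `uPlus β ∈ U⁺`. -/
theorem uPlus_mem (β : ZMod p) : uPlus β ∈ Uplus p := Finset.mem_image_of_mem _ (Finset.mem_univ _)
/-- `torU a d ∈ T`. -/
theorem torU_mem (a d : (ZMod p)ˣ) : torU a d ∈ Torus p :=
  Finset.mem_image_of_mem (fun ad : (ZMod p)ˣ × (ZMod p)ˣ => torU ad.1 ad.2) (Finset.mem_univ (a, d))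

/-- `[1 0; 0 1] = 1`. -/
theorem uMinus_zero : uMinus (0 : ZMod p) = 1 := by
  apply Units.ext; simp [Matrix.one_fin_two]

/-- `[1 0; 0 1] = 1`. -/
theorem uPlus_zero : uPlus (0 : ZMod p) = 1 := by
  apply Units.ext; simp [Matrix.one_fin_two]

/-- `uMinus γ = 1 ↔ γ = 0`. -/
theorem uMinus_eq_one_iff (γ : ZMod p) : uMinus γ = 1 ↔ γ = 0 := by
  rw [← uMinus_zero]; exact uMinus_injective.eq_iff

/-- `uPlus β = 1 ↔ β = 0`. -/
theorem uPlus_eq_one_iff (β : ZMod p) : uPlus β = 1 ↔ β = 0 := by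
  rw [← uPlus_zero]; exact uPlus_injective.eq_iff

/-- `diag(a, d) = 1 ↔ a = 1 ∧ d = 1`. -/
theorem torU_eq_one_iff (a d : (ZMod p)ˣ) : torU a d = 1 ↔ a = 1 ∧ d = 1 := by
  rw [← torU_one]
  constructor
  · intro h
    have := torU_injective (a₁ := (a, d)) (a₂ := (1, 1)) h
    exact ⟨(Prod.ext_iff.mp this).1, (Prod.ext_iff.mp this).2⟩
  · rintro ⟨rfl, rfl⟩; rfl

/-- `U⁻` is a one-parameter subgroup. -/
theorem uMinus_add (γ δ : ZMod p) : uMinus γ * uMinus δ = uMinus (γ + δ) := by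
  apply Units.ext; simp

/-- `U⁺` is a one-parameter subgroup. -/
theorem uPlus_add (β δ : ZMod p) : uPlus β * uPlus δ = uPlus (β + δ) := by
  apply Units.ext; simp [add_comm]

/-- `T` is a subgroup. -/
theorem torU_mul (a d a' d' : (ZMod p)ˣ) : torU a d * torU a' d' = torU (a * a') (d * d') := by
  apply Units.ext; simp

/-- `[1 0; γ 1]⁻¹ = [1 0; −γ 1]`. -/
theorem uMinus_inv (γ : ZMod p) : (uMinus γ)⁻¹ = uMinus (-γ) := by
  rw [← uMinus_neg_inv (-γ), neg_neg]

/-- `[1 β; 0 1]⁻¹ = [1 −β; 0 1]`. -/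
theorem uPlus_inv (β : ZMod p) : (uPlus β)⁻¹ = uPlus (-β) := by
  rw [inv_eq_iff_mul_eq_one, uPlus_add, add_neg_cancel, uPlus_zero]

/-- `diag(a, d)⁻¹ = diag(a⁻¹, d⁻¹)`. -/
theorem torU_inv (a d : (ZMod p)ˣ) : (torU a d)⁻¹ = torU a⁻¹ d⁻¹ := by
  rw [inv_eq_iff_mul_eq_one, torU_mul, mul_inv_cancel, mul_inv_cancel, torU_one]

/-- LDU uniqueness at the identity: `[1 0; γ 1]·diag(a,d)·[1 β; 0 1] = 1` forces all three factors
to be trivial. [folklore] -/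
theorem ldu_eq_one {γ β : ZMod p} {a d : (ZMod p)ˣ} (h : uMinus γ * torU a d * uPlus β = 1) :
    γ = 0 ∧ (a = 1 ∧ d = 1) ∧ β = 0 := by
  have hM := congrArg (fun g : GLm p 2 => (g : Mat p 2)) h
  simp only [coe_ldu, Units.val_one] at hM
  have h00 := congrFun (congrFun hM 0) 0
  have h01 := congrFun (congrFun hM 0) 1
  have h10 := congrFun (congrFun hM 1) 0
  have h11 := congrFun (congrFun hM 1) 1
  simp only [Matrix.of_apply, Matrix.cons_val', Matrix.cons_val_zero, Matrix.cons_val_one,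
    Matrix.cons_val_fin_one, Matrix.one_apply_eq, Matrix.one_apply_ne (by decide : (0 : Fin 2) ≠ 1),
    Matrix.one_apply_ne (by decide : (1 : Fin 2) ≠ 0)] at h00 h01 h10 h11
  have ha : a = 1 := Units.ext (by simpa using h00)
  subst ha
  simp only [Units.val_one, one_mul, mul_one] at h01 h10 h11
  subst h01; subst h10
  simp only [zero_mul, zero_add] at h11
  exact ⟨rfl, ⟨rfl, Units.ext (by simpa using h11)⟩, rfl⟩

/-- **The Borel configuration has the triple product property** (LDU uniqueness). -/
theorem borelConfiguration_tpp :
    Literature.Combinatorics.Additive.TripleProductProperty (Uminus p) (Torus p) (Uplus p) := by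
  classical
  intro x hx x' hx' y hy y' hy' z hz z' hz' h1
  simp only [Uminus, Torus, Uplus, Finset.mem_image, Finset.mem_univ, true_and] at hx hx' hy hy' hz hz'
  obtain ⟨γ, rfl⟩ := hx
  obtain ⟨γ', rfl⟩ := hx'
  obtain ⟨⟨a, d⟩, rfl⟩ := hy
  obtain ⟨⟨a', d'⟩, rfl⟩ := hy'
  obtain ⟨β, rfl⟩ := hz
  obtain ⟨β', rfl⟩ := hz'
  rw [uMinus_inv, uMinus_add, torU_inv, torU_mul, uPlus_inv, uPlus_add] at h1
  obtain ⟨hγ, ⟨ha, hd⟩, hβ⟩ := ldu_eq_one h1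
  have hγ' : γ = γ' := by linear_combination hγ
  have hβ' : β = β' := by linear_combination hβ
  simp only [mul_inv_eq_one] at ha hd
  subst hγ' hβ'
  simp only at ha hd ⊢
  rw [ha, hd]
  simp

/-- **Volume of the Borel configuration**: `|U⁻||T||U⁺| = p²(p−1)²` (`= |GL_2(𝔽_p)|·p/(p+1)`). -/
theorem borelConfiguration_volume :
    (Uminus p).card * (Torus p).card * (Uplus p).card = p ^ 2 * (p - 1) ^ 2 := by
  rw [card_Uminus, card_Torus, card_Uplus]; ring

end Summit.MatrixMultiplication.MatrixMultiplication.Theorems.LieRankBeatsCubes.Negative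

end
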